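import Literature.Computability.Cryptography.ExtLWE
import Literature.Computability.Cryptography.LWESecretLaws
import Literature.Probability.Distributions.IndepProductLawKernels
import Literature.Computability.Cryptography.IndepLawBridge
import HarnessLib

/-!
# The hybrid chain of BLPRS 2013, Lemma 4.9 (`extLWE^m` + `LWE_k` ⇒ binary-secret `LWE_n`), discrete part

Topic `Computability/Cryptography` (LWE), grouping namespace `LWE`. Proved material (no named fact) towards
`Literature.Computability.Cryptography.blprs_gapSVP_sqrt_dim_to_lwe_classical` (**pqc.S21**;
Brakerski–Langlois–Peikert–Regev–Stehlé, STOC 2013): the hybrid argument of **Lemma 4.9** (the step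
`extLWE → binLWE` of Thm. 4.1, hypothesis `h₃` of `BLPRSReduction.lean`) in the tree's discrete `×q` model
(`ExtLWE.lean`, `LWESecretLaws.lean`), from its second hybrid on:

> *Proof.* The proof follows by a sequence of hybrids. … `H₀ = (A, b = Aᵀz + e)` … `H₁ = (A, Aᵀz - Nᵀz + h)`
> where `N ← D^{n×m}_{q⁻¹ℤ,β}` and `h ← D_γ^m` [`|Pr[𝒜(H₀)] - Pr[𝒜(H₁)]| ≤ 4mε` by Lemma 2.9] … Let
> `B ← 𝕋_q^{k×m}`, `C ← 𝕋_q^{k×n}`, `Â = qCᵀB + N`, `H₂ = (Â, Âᵀz - Nᵀz + h) = (Â, qBᵀCz + h)`. There exists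
> an adversary `ℬ₁` for `extLWE^m_{k,n,q,β,{0,1}ⁿ}` such that `Adv[ℬ₁] = |Pr[𝒜(H₁)] - Pr[𝒜(H₂)]|`, because
> `H₁, H₂` can be viewed as applying the same efficient transformation on `(C, A, Nᵀz)` and `(C, Â, Nᵀz)`. …
> `H₃ = (Â, Bᵀs + h)`, `s ← ℤ_q^k`: `|Pr[𝒜(H₂)] - Pr[𝒜(H₃)]| ≤ δ` by the leftover hash lemma, since `H₂, H₃`
> can be derived from `(C, qCz)` and `(C, s)` respectively. … `H₄ = (Â, u)`: there exists `ℬ₂` for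
> `LWE_{k,m,q,γ}` with `Adv[ℬ₂] = |Pr[𝒜(H₃)] - Pr[𝒜(H₄)]|`, since `H₃, H₄` can be computed from
> `(B, Bᵀs + h), (B, u)`. Lastly `H₅ = (A, u)`: there exists `ℬ₃` for `extLWE^m_{k,n,q,β,{0ⁿ}}` with
> `Adv[ℬ₃] = |Pr[𝒜(H₄)] - Pr[𝒜(H₅)]|` … (arXiv:1306.0281, pp. 16–17).

Everything from `H₁` on is exact algebra of finite distributions and is PROVED here, for an arbitrary
law `ζ` of the binary (integer) secret `z`, arbitrary integer noise columns `χ_N` (the law of a column of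
`N`, in `ℤⁿ`) and arbitrary ring noise `χ_h` (the law of a coordinate of `h`), over any finite commutative
ring `R` (`ℤ_q`); samples are in the tree's format `Fin m → (Fin n → R) × R` (`aᵢ` = column `i` of `A`).
The one analytic step `H₀ ≈_{4mε} H₁` (Lemma 2.9: `-Nᵀz + h ≈ D_{α'}^m`, continuous Gaussians) is NOT
here; in this model it is the statement that the secret-dependent noise law `noiseH₁ χ_N χ_h z` (the law
of `h - ⟨e, z⟩`) is close to the target noise, to be supplied at measure level.

## Results (paper's names: `k` = LWE dimension, `n` = binary-secret dimension, `m` = samples)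

* the hybrids as laws: `hybridH₁ … ζ` (= `lweSamplesSecretNoiseLaw (noiseH₁ χ_N χ_h) (ζ.map intCastVec) m`,
  `hybridH₁_eq`), `posLaw`/`hybridH₂`/`hybridH₃` (through the kernel `(C, w) ↦ ⨂ᵢ (Cᵀsᵢ + eᵢ, ⟨sᵢ, w⟩ + hᵢ)`
  applied to `lawCz ζ` = law of `(C, Cz)` resp. to the uniform pair), `posLaw₄`/`hybridH₄`, and
  `H₅ = uniformSamples`;
* the three transformations `hybridT₁ χ_h m z` (on `extLWE^m` transcripts, uses `z` and fresh `h`),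
  `hybridT₂ χ_N m` (on `m` `LWE_k`-samples, fresh `C`, `N`), `hybridT₃ m` (on `extLWE^m` transcripts with
  `z = 0`, fresh `u`) and the SIX law identities `extLWEIdeal_bind_hybridT₁` (`→ H₁`),
  `extLWEReal_bind_hybridT₁` (`→ H₂`), `lweSamplesUniformSecret_bind_hybridT₂` (`→ H₃`),
  `uniformSamples_bind_hybridT₂` (`→ H₄`), `extLWEReal_zero_bind_hybridT₃` (`→ H₄`),
  `extLWEIdeal_zero_bind_hybridT₃` (`→ H₅`);
* `extLWEAdvantageZ ζ` — the advantage on `extLWE^m` when the adversary draws its `z ← ζ` (the game of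
  Def. 4.4 with `𝒵 ⊇ supp ζ`), and **`advantage_hybridH₁_le`** (Lemma 4.9 from `H₁` on):
  `|Pr[𝒜(H₁)] - Pr[𝒜(U)]| ≤ Adv^{extLWE^m,ζ}[ℬ₁] + Δ((C, Cz); U) + Adv^{LWE_{k,m,χ_h}}[ℬ₂] + Adv^{extLWE^m,0}[ℬ₃]`
  with the explicit `ℬ₁ = 𝒜 ∘ hybridT₁`, `ℬ₂ = 𝒜 ∘ hybridT₂`, `ℬ₃ = 𝒜 ∘ hybridT₃`; the middle term is bounded
  by `blprs_lemma_2_2` (`LeftoverHashUniversal.lean`) for `ζ` uniform on `{0,1}ⁿ`.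

## References

* Z. Brakerski, A. Langlois, C. Peikert, O. Regev, D. Stehlé, *Classical hardness of learning with errors*,
  STOC 2013; arXiv:1306.0281, §4.3, Lemma 4.9 and its proof (pp. 16–17); Def. 4.4, Lemma 2.2.
-/

noncomputable section

open scoped ENNReal
open Matrix Literature.Probability.Distributions

namespace Literature.Computability.Cryptography

namespace LWE

section Model

variable {R : Type} [CommRing R] [Fintype R] {k n : ℕ}

/-- An integer vector read in the ring `R` (`ℤⁿ → ℤ_qⁿ`). [folklore] -/
def intCastVec (e : Fin n → ℤ) : Fin n → R := fun j => (e j : R)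

omit [Fintype R] in
/-- `⟨e, z⟩` computed in `ℤ` and then read in `R` is `⟨ē, z̄⟩`. [folklore] -/
theorem cast_dotProduct (e z : Fin n → ℤ) : ((e ⬝ᵥ z : ℤ) : R) = intCastVec e ⬝ᵥ (intCastVec z : Fin n → R) := by
  simp [dotProduct, intCastVec]

omit [Fintype R] in
/-- `⟨Cᵀ s, v⟩ = ⟨s, C v⟩`. [folklore] -/
theorem transpose_mulVec_dotProduct (C : Matrix (Fin k) (Fin n) R) (s : Fin k → R) (v : Fin n → R) :
    (Cᵀ *ᵥ s) ⬝ᵥ v = s ⬝ᵥ (C *ᵥ v) := by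
  rw [mulVec_transpose, dotProduct_mulVec]

/-! ### The hybrids `H₁, …, H₅` -/

/-- The secret-dependent noise law of `H₁`: the law of `h - ⟨ē, s⟩`, `e ← χ_N`, `h ← χ_h` (one coordinate
of `-Nᵀz + h` for the secret `s = z̄`). [cite: BrakerskiEtAl2013, Lemma 4.9 (proof, hybrid H₁)] -/
def noiseH₁ (χN : PMF (Fin n → ℤ)) (χh : PMF R) (s : Fin n → R) : PMF R :=
  χN.bind fun e => χh.map fun h => h - intCastVec e ⬝ᵥ s

/-- **`H₁ = (A, Aᵀz - Nᵀz + h)`** with `z ← ζ`: `m` samples `(aᵢ, ⟨aᵢ, z̄⟩ + (hᵢ - ⟨ēᵢ, z̄⟩))`, i.e. `LWE` with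
secret law `ζ̄` and the secret-dependent noise `noiseH₁`. [cite: BrakerskiEtAl2013, Lemma 4.9 (proof, hybrid H₁)] -/
def hybridH₁ (χN : PMF (Fin n → ℤ)) (χh : PMF R) (m : ℕ) (ζ : PMF (Fin n → ℤ)) :
    PMF (Fin m → (Fin n → R) × R) :=
  ζ.bind fun z => lweSamples (noiseH₁ χN χh (intCastVec z)) (intCastVec z : Fin n → R) m

/-- `H₁` is the tree's `lweSamplesSecretNoiseLaw` for the secret law `ζ̄ = ζ.map intCastVec`.
[cite: BrakerskiEtAl2013, Lemma 4.9 (proof) with Def. 2.11 / 2.14] -/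
theorem hybridH₁_eq (χN : PMF (Fin n → ℤ)) (χh : PMF R) (m : ℕ) (ζ : PMF (Fin n → ℤ)) :
    hybridH₁ χN χh m ζ = lweSamplesSecretNoiseLaw (noiseH₁ χN χh) (ζ.map intCastVec) m := by
  rw [lweSamplesSecretNoiseLaw, PMF.bind_map]
  rfl

/-- The position law of `H₂`/`H₃` given `C` and the inner secret `w ∈ Rᵏ`: `s ← U(Rᵏ)`, `e ← χ_N`, `h ← χ_h`,
output `(Cᵀs + ē, ⟨s, w⟩ + h)` (a column of `Â = CᵀB + N` and a coordinate of `Bᵀw + h`).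
[cite: BrakerskiEtAl2013, Lemma 4.9 (proof, hybrids H₂ H₃)] -/
def posLaw (χN : PMF (Fin n → ℤ)) (χh : PMF R) (C : Matrix (Fin k) (Fin n) R) (w : Fin k → R) :
    PMF ((Fin n → R) × R) :=
  (PMF.uniformOfFintype (Fin k → R)).bind fun s => χN.bind fun e => χh.map fun h =>
    (Cᵀ *ᵥ s + intCastVec e, s ⬝ᵥ w + h)

/-- The law of `(C, C z̄)` for `C ← U(R^{k×n})`, `z ← ζ` — the source side of the leftover hash lemma.
[cite: BrakerskiEtAl2013, Lemma 4.9 (proof: "derived from (C, qCz)")] -/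
def lawCz (k : ℕ) (ζ : PMF (Fin n → ℤ)) : PMF (Matrix (Fin k) (Fin n) R × (Fin k → R)) :=
  ζ.bind fun z => (PMF.uniformOfFintype (Matrix (Fin k) (Fin n) R)).map fun C => (C, C *ᵥ intCastVec z)

/-- The common kernel of `H₂` and `H₃`: `(C, w) ↦ ⨂ᵢ posLaw C w`. [cite: BrakerskiEtAl2013, Lemma 4.9 (proof)] -/
def hybridG (χN : PMF (Fin n → ℤ)) (χh : PMF R) (m : ℕ) (p : Matrix (Fin k) (Fin n) R × (Fin k → R)) :
    PMF (Fin m → (Fin n → R) × R) :=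
  iidPMF (posLaw χN χh p.1 p.2) m

/-- **`H₂ = (Â, Bᵀ(Cz) + h)`** with `z ← ζ`. [cite: BrakerskiEtAl2013, Lemma 4.9 (proof, hybrid H₂)] -/
def hybridH₂ (χN : PMF (Fin n → ℤ)) (χh : PMF R) (m : ℕ) (ζ : PMF (Fin n → ℤ)) :
    PMF (Fin m → (Fin n → R) × R) :=
  (lawCz k ζ).bind (hybridG χN χh m)

variable (k) in
/-- **`H₃ = (Â, Bᵀs + h)`** with `s ← U(Rᵏ)` independent of `C`. [cite: BrakerskiEtAl2013, Lemma 4.9 (proof, hybrid H₃)] -/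
def hybridH₃ (χN : PMF (Fin n → ℤ)) (χh : PMF R) (m : ℕ) : PMF (Fin m → (Fin n → R) × R) :=
  (PMF.uniformOfFintype (Matrix (Fin k) (Fin n) R × (Fin k → R))).bind (hybridG χN χh m)

/-- The position law of `H₄` given `C`: `(Cᵀa + ē, u)` with `a ← U(Rᵏ)`, `e ← χ_N`, `u ← U(R)`.
[cite: BrakerskiEtAl2013, Lemma 4.9 (proof, hybrid H₄)] -/
def posLaw₄ (χN : PMF (Fin n → ℤ)) (C : Matrix (Fin k) (Fin n) R) : PMF ((Fin n → R) × R) :=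
  (PMF.uniformOfFintype (Fin k → R)).bind fun a => χN.bind fun e =>
    (PMF.uniformOfFintype R).map fun u => (Cᵀ *ᵥ a + intCastVec e, u)

variable (k) in
/-- **`H₄ = (Â, u)`**. [cite: BrakerskiEtAl2013, Lemma 4.9 (proof, hybrid H₄)] -/
def hybridH₄ (χN : PMF (Fin n → ℤ)) (m : ℕ) : PMF (Fin m → (Fin n → R) × R) :=
  (PMF.uniformOfFintype (Matrix (Fin k) (Fin n) R)).bind fun C => iidPMF (posLaw₄ χN C) m

/-! ### The three transformations -/

/-- **`ℬ₁`'s transformation** on an `extLWE^m` transcript `(C, (bᵢ, yᵢ)ᵢ)` for the choice `z`, with fresh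
`h ← χ_h^m`: sample `i` is `(bᵢ, ⟨bᵢ, z̄⟩ - ȳᵢ + hᵢ)` ("applying the same efficient transformation on
`(C, A, Nᵀz)` and `(C, Â, Nᵀz)`"). [cite: BrakerskiEtAl2013, Lemma 4.9 (proof, ℬ₁)] -/
def hybridT₁ (χh : PMF R) (m : ℕ) (z : Fin n → ℤ)
    (τ : Matrix (Fin k) (Fin n) R × (Fin m → (Fin n → R) × ℤ)) : PMF (Fin m → (Fin n → R) × R) :=
  (iidPMF χh m).map fun h i => ((τ.2 i).1, (τ.2 i).1 ⬝ᵥ (intCastVec z : Fin n → R) - ((τ.2 i).2 : R) + h i)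

/-- **`ℬ₂`'s transformation** on `m` samples `(aᵢ, bᵢ)` of `LWE_k`, with fresh `C ← U(R^{k×n})` and noise
columns `eᵢ ← χ_N`: sample `i` becomes `(Cᵀaᵢ + ēᵢ, bᵢ)` ("`H₃, H₄` can be computed efficiently from
`(B, Bᵀs + h), (B, u)`"). [cite: BrakerskiEtAl2013, Lemma 4.9 (proof, ℬ₂)] -/
def hybridT₂ (χN : PMF (Fin n → ℤ)) (m : ℕ) (S : Fin m → (Fin k → R) × R) :
    PMF (Fin m → (Fin n → R) × R) :=
  (PMF.uniformOfFintype (Matrix (Fin k) (Fin n) R)).bind fun C =>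
    (iidPMF χN m).map fun es i => (Cᵀ *ᵥ (S i).1 + intCastVec (es i), (S i).2)

/-- **`ℬ₃`'s transformation** on an `extLWE^m` transcript with `z = 0`, with fresh `u ← U(R)^m`: sample `i`
is `(bᵢ, uᵢ)`. [cite: BrakerskiEtAl2013, Lemma 4.9 (proof, ℬ₃)] -/
def hybridT₃ (m : ℕ) (τ : Matrix (Fin k) (Fin n) R × (Fin m → (Fin n → R) × ℤ)) :
    PMF (Fin m → (Fin n → R) × R) :=
  (iidPMF (PMF.uniformOfFintype R) m).map fun u i => ((τ.2 i).1, u i)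

/-! ### Generic glue -/

omit [Fintype R] in
/-- Binding a transcript law `U(C) ⋉ (w ↦ (C, w))` with a kernel that ignores `C`. [folklore] -/
theorem bind_transcript_of_forall {α β γ : Type} [Fintype α] [Nonempty α] (P : α → PMF β) (K : α × β → PMF γ)
    (K' : β → PMF γ) (hK : ∀ a w, K (a, w) = K' w) :
    ((PMF.uniformOfFintype α).bind fun a => (P a).map fun w => (a, w)).bind K =
      (PMF.uniformOfFintype α).bind fun a => (P a).bind K' := by
  rw [PMF.bind_bind]
  refine congrArg _ (funext fun a => ?_)
  rw [PMF.bind_map]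
  exact congrArg _ (funext fun w => hK a w)

omit [CommRing R] [Fintype R] in
/-- **Coordinatewise randomised maps on an independent tuple** (the tree's `indepLaw_bind_indepLaw_map` for
iid coins): `(⨂ᵢ μᵢ) ≫= (w ↦ (ν^{⊗m}).map (h ↦ (F (wᵢ) (hᵢ))ᵢ)) = ⨂ᵢ (μᵢ ≫= (p ↦ ν.map (F p)))`. [folklore] -/
theorem indepLaw_bind_iidPMF_map {α β γ : Type} (m : ℕ) (μ : Fin m → PMF α) (ν : PMF β) (F : α → β → γ) :
    ((indepLaw m μ).bind fun w => (iidPMF ν m).map fun h i => F (w i) (h i)) =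
      indepLaw m fun i => (μ i).bind fun p => ν.map (F p) := by
  rw [← indepLaw_const ν m]
  exact indepLaw_bind_indepLaw_map m μ (fun _ => ν) fun _ => F

omit [CommRing R] [Fintype R] in
/-- The iid version. [folklore] -/
theorem iidPMF_bind_iidPMF_map {α β γ : Type} (m : ℕ) (μ : PMF α) (ν : PMF β) (F : α → β → γ) :
    ((iidPMF μ m).bind fun w => (iidPMF ν m).map fun h i => F (w i) (h i)) =
      iidPMF (μ.bind fun p => ν.map (F p)) m := by
  rw [← indepLaw_const μ m, indepLaw_bind_iidPMF_map, indepLaw_const]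

omit [CommRing R] [Fintype R] in
/-- `map` as `bind`/`pure` (definitional; used to normalise laws to nested binds). [folklore] -/
theorem map_eq_bind_pure' {α β : Type} (p : PMF α) (f : α → β) :
    p.map f = p.bind fun a => PMF.pure (f a) := rfl

/-! ### The six law identities -/

/-- **`ℬ₁` fed the SECOND (uniform) case of `extLWE^m` produces `H₁`**: position `i` becomes
`(bᵢ, ⟨bᵢ, z̄⟩ + (hᵢ - ⟨ēᵢ, z̄⟩))` with `bᵢ` uniform — an `LWE` sample for the secret `z̄` with noise
`noiseH₁`. [cite: BrakerskiEtAl2013, Lemma 4.9 (proof, ℬ₁)] -/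
theorem extLWEIdeal_bind_hybridT₁ (χN : PMF (Fin n → ℤ)) (χh : PMF R) (m : ℕ) (z : Fin n → ℤ) :
    (extLWEIdeal k χN m z).bind (hybridT₁ χh m z) =
      lweSamples (noiseH₁ χN χh (intCastVec z)) (intCastVec z : Fin n → R) m := by
  unfold extLWEIdeal hybridT₁
  rw [bind_transcript_of_forall _ _ (fun w => (iidPMF χh m).map fun h i =>
      ((w i).1, (w i).1 ⬝ᵥ (intCastVec z : Fin n → R) - ((w i).2 : R) + h i)) (fun C w => rfl), PMF.bind_const,
    indepLaw_bind_iidPMF_map m (fun _ => extLWEUniformSample χN z) χh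
      (fun p h => (p.1, p.1 ⬝ᵥ (intCastVec z : Fin n → R) - (p.2 : R) + h)), indepLaw_const, lweSamples]
  congr 1
  unfold extLWEUniformSample lweSample noiseH₁
  simp only [map_eq_bind_pure', PMF.bind_bind, PMF.pure_bind]
  refine congrArg _ (funext fun b => congrArg _ (funext fun e => congrArg _ (funext fun h => ?_)))
  rw [cast_dotProduct]
  congr 1
  refine Prod.ext rfl ?_
  simp only
  ring

/-- **`ℬ₁` fed the FIRST case of `extLWE^m` produces `H₂`**: with `bᵢ = Cᵀsᵢ + ēᵢ`,
`⟨bᵢ, z̄⟩ - ⟨ēᵢ, z̄⟩ + hᵢ = ⟨sᵢ, C z̄⟩ + hᵢ`. [cite: BrakerskiEtAl2013, Lemma 4.9 (proof, ℬ₁)] -/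
theorem extLWEReal_bind_hybridT₁ (χN : PMF (Fin n → ℤ)) (χh : PMF R) (m : ℕ) (z : Fin n → ℤ) :
    (extLWEReal (n := k) χN m z).bind (hybridT₁ χh m z) =
      (PMF.uniformOfFintype (Matrix (Fin k) (Fin n) R)).bind fun C =>
        hybridG χN χh m (C, C *ᵥ intCastVec z) := by
  unfold extLWEReal hybridT₁
  rw [bind_transcript_of_forall _ _ (fun w => (iidPMF χh m).map fun h i =>
      ((w i).1, (w i).1 ⬝ᵥ (intCastVec z : Fin n → R) - ((w i).2 : R) + h i)) (fun C w => rfl)]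
  refine congrArg _ (funext fun C => ?_)
  rw [indepLaw_bind_iidPMF_map m (fun _ => extLWESecretSample χN C z) χh
      (fun p h => (p.1, p.1 ⬝ᵥ (intCastVec z : Fin n → R) - (p.2 : R) + h)), indepLaw_const, hybridG]
  dsimp only
  congr 1
  unfold extLWESecretSample posLaw
  simp only [map_eq_bind_pure', PMF.bind_bind, PMF.pure_bind]
  refine congrArg _ (funext fun s => congrArg _ (funext fun e => congrArg _ (funext fun h => ?_)))
  congr 1
  refine Prod.ext rfl ?_
  simp only
  rw [add_dotProduct, transpose_mulVec_dotProduct, show (fun j => (e j : R)) = intCastVec e from rfl,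
    ← cast_dotProduct]
  ring

/-- **`ℬ₂` fed `LWE_{k,m,χ_h}` with a uniform secret produces `H₃`.** [cite: BrakerskiEtAl2013, Lemma 4.9 (proof, ℬ₂)] -/
theorem lweSamplesUniformSecret_bind_hybridT₂ (χN : PMF (Fin n → ℤ)) (χh : PMF R) (m : ℕ) :
    (lweSamplesUniformSecret χh m).bind (hybridT₂ (k := k) χN m) = hybridH₃ k χN χh m := by
  -- both sides as `U(C) ≫= U(s) ≫= …`
  have hR : (hybridH₃ k χN χh m : PMF (Fin m → (Fin n → R) × R)) =
      (PMF.uniformOfFintype (Matrix (Fin k) (Fin n) R)).bind fun C =>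
        (PMF.uniformOfFintype (Fin k → R)).bind fun s => hybridG χN χh m (C, s) := by
    unfold hybridH₃
    rw [← prodLaw_uniformOfFintype, prodLaw, PMF.bind_bind]
    refine congrArg _ (funext fun C => ?_)
    rw [PMF.bind_map]
    rfl
  have hL : (lweSamplesUniformSecret χh m).bind (hybridT₂ (k := k) χN m) =
      (PMF.uniformOfFintype (Fin k → R)).bind fun s =>
        (PMF.uniformOfFintype (Matrix (Fin k) (Fin n) R)).bind fun C =>
          (lweSamples χh s m).bind fun S => (iidPMF χN m).map fun es i =>
            (Cᵀ *ᵥ (S i).1 + intCastVec (es i), (S i).2) := by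
    unfold lweSamplesUniformSecret hybridT₂
    rw [PMF.bind_bind]
    refine congrArg _ (funext fun s => ?_)
    rw [PMF.bind_comm (lweSamples χh s m)]
  rw [hL, hR, PMF.bind_comm (PMF.uniformOfFintype (Fin k → R))]
  refine congrArg _ (funext fun C => congrArg _ (funext fun s => ?_))
  rw [lweSamples, iidPMF_bind_iidPMF_map m (lweSample χh s) χN
      (fun p e => (Cᵀ *ᵥ p.1 + intCastVec e, p.2)), hybridG]
  dsimp only
  congr 1
  unfold lweSample posLaw
  simp only [map_eq_bind_pure', PMF.bind_bind, PMF.pure_bind]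
  refine congrArg _ (funext fun a => ?_)
  rw [PMF.bind_comm χh χN]

/-- **`ℬ₂` fed uniform samples produces `H₄`.** [cite: BrakerskiEtAl2013, Lemma 4.9 (proof, ℬ₂)] -/
theorem uniformSamples_bind_hybridT₂ (χN : PMF (Fin n → ℤ)) (m : ℕ) :
    (uniformSamples (Fin k) R m).bind (hybridT₂ (n := n) χN m) = hybridH₄ k χN m := by
  unfold hybridT₂ hybridH₄
  rw [uniformSamples_eq_iidPMF_holds, PMF.bind_comm (iidPMF _ m)]
  refine congrArg _ (funext fun C => ?_)
  rw [iidPMF_bind_iidPMF_map m (PMF.uniformOfFintype ((Fin k → R) × R)) χN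
      (fun p e => (Cᵀ *ᵥ p.1 + intCastVec e, p.2))]
  congr 1
  unfold posLaw₄
  rw [← prodLaw_uniformOfFintype, prodLaw]
  simp only [map_eq_bind_pure', PMF.bind_bind, PMF.pure_bind]
  refine congrArg _ (funext fun a => ?_)
  rw [PMF.bind_comm (PMF.uniformOfFintype R) χN]

/-- **`ℬ₃` fed the FIRST case of `extLWE^m` (with `z = 0`) produces `H₄`.** [cite: BrakerskiEtAl2013, Lemma 4.9 (proof, ℬ₃)] -/
theorem extLWEReal_zero_bind_hybridT₃ (χN : PMF (Fin n → ℤ)) (m : ℕ) :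
    (extLWEReal (n := k) χN m (0 : Fin n → ℤ)).bind (hybridT₃ m) = (hybridH₄ k χN m : PMF (Fin m → (Fin n → R) × R)) := by
  unfold extLWEReal hybridT₃ hybridH₄
  rw [bind_transcript_of_forall _ _ (fun w => (iidPMF (PMF.uniformOfFintype R) m).map fun u i =>
      ((w i).1, u i)) (fun C w => rfl)]
  refine congrArg _ (funext fun C => ?_)
  rw [indepLaw_bind_iidPMF_map m (fun _ => extLWESecretSample χN C 0) (PMF.uniformOfFintype R)
      (fun p u => (p.1, u)), indepLaw_const]
  congr 1
  unfold extLWESecretSample posLaw₄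
  simp only [map_eq_bind_pure', PMF.bind_bind, PMF.pure_bind]
  rfl

/-- **`ℬ₃` fed the SECOND case of `extLWE^m` (with `z = 0`) produces `H₅ = U`.** [cite: BrakerskiEtAl2013, Lemma 4.9 (proof, ℬ₃)] -/
theorem extLWEIdeal_zero_bind_hybridT₃ (χN : PMF (Fin n → ℤ)) (m : ℕ) :
    (extLWEIdeal k χN m (0 : Fin n → ℤ)).bind (hybridT₃ (R := R) m) = uniformSamples (Fin n) R m := by
  unfold extLWEIdeal hybridT₃
  rw [bind_transcript_of_forall _ _ (fun w => (iidPMF (PMF.uniformOfFintype R) m).map fun u i =>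
      ((w i).1, u i)) (fun C w => rfl), PMF.bind_const,
    indepLaw_bind_iidPMF_map m (fun _ => extLWEUniformSample χN 0) (PMF.uniformOfFintype R)
      (fun p u => (p.1, u)), indepLaw_const, uniformSamples_eq_iidPMF_holds]
  congr 1
  unfold extLWEUniformSample
  rw [PMF.bind_bind, ← prodLaw_uniformOfFintype, prodLaw]
  refine congrArg _ (funext fun b => ?_)
  rw [PMF.bind_map]
  show (χN.bind fun _ => (PMF.uniformOfFintype R).map (Prod.mk b)) = _
  exact PMF.bind_const _ _

/-! ### Acceptance probabilities of the three adversaries -/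

variable (k) in
/-- The `extLWE^m` game in which the adversary draws its `z ← ζ` first (Def. 4.4 with `𝒵 ⊇ supp ζ`; the
transcript carries `z`): FIRST case. [cite: BrakerskiEtAl2013, Def. 4.4] -/
def extLWERealZ (ζ : PMF (Fin n → ℤ)) (χN : PMF (Fin n → ℤ)) (m : ℕ) :
    PMF ((Fin n → ℤ) × (Matrix (Fin k) (Fin n) R × (Fin m → (Fin n → R) × ℤ))) :=
  ζ.bind fun z => (extLWEReal (n := k) χN m z).map (Prod.mk z)

variable (k) in
/-- The same, SECOND case. [cite: BrakerskiEtAl2013, Def. 4.4] -/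
def extLWEIdealZ (ζ : PMF (Fin n → ℤ)) (χN : PMF (Fin n → ℤ)) (m : ℕ) :
    PMF ((Fin n → ℤ) × (Matrix (Fin k) (Fin n) R × (Fin m → (Fin n → R) × ℤ))) :=
  ζ.bind fun z => (extLWEIdeal k χN m z).map (Prod.mk z)

/-- The advantage on `extLWE^m` of an adversary drawing `z ← ζ`. [cite: BrakerskiEtAl2013, Def. 4.4] -/
def extLWEAdvantageZ (ζ : PMF (Fin n → ℤ)) (χN : PMF (Fin n → ℤ)) (m : ℕ)
    (D : (Fin n → ℤ) × (Matrix (Fin k) (Fin n) R × (Fin m → (Fin n → R) × ℤ)) → PMF Bool) : ℝ :=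
  |(acceptProb D (extLWERealZ k ζ χN m)).toReal - (acceptProb D (extLWEIdealZ k ζ χN m)).toReal|

/-- `ℬ₁ = 𝒜 ∘ hybridT₁` (uses the drawn `z`). [cite: BrakerskiEtAl2013, Lemma 4.9 (proof, ℬ₁)] -/
def hybridB₁ (χh : PMF R) (m : ℕ) (A : Distinguisher (Fin n) R m) :
    (Fin n → ℤ) × (Matrix (Fin k) (Fin n) R × (Fin m → (Fin n → R) × ℤ)) → PMF Bool :=
  fun p => (hybridT₁ χh m p.1 p.2).bind A

/-- `ℬ₂ = 𝒜 ∘ hybridT₂`, a distinguisher for `LWE_{k,m,χ_h}`. [cite: BrakerskiEtAl2013, Lemma 4.9 (proof, ℬ₂)] -/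
def hybridB₂ (χN : PMF (Fin n → ℤ)) (m : ℕ) (A : Distinguisher (Fin n) R m) : Distinguisher (Fin k) R m :=
  fun S => (hybridT₂ χN m S).bind A

/-- `ℬ₃ = 𝒜 ∘ hybridT₃`, an adversary for `extLWE^m` with `z = 0`. [cite: BrakerskiEtAl2013, Lemma 4.9 (proof, ℬ₃)] -/
def hybridB₃ (m : ℕ) (A : Distinguisher (Fin n) R m) :
    Matrix (Fin k) (Fin n) R × (Fin m → (Fin n → R) × ℤ) → PMF Bool :=
  fun τ => (hybridT₃ m τ).bind A

omit [CommRing R] [Fintype R] in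
/-- Precomposition with a kernel moves into the input law. [folklore] -/
theorem acceptProb_comp_bind {β γ : Type} (T : β → PMF γ) (A : γ → PMF Bool) (P : PMF β) :
    acceptProb (fun x => (T x).bind A) P = acceptProb A (P.bind T) := by
  unfold acceptProb
  rw [PMF.bind_bind]

/-- `Pr[ℬ₁ | second case] = Pr[𝒜(H₁)]`. [cite: BrakerskiEtAl2013, Lemma 4.9 (proof)] -/
theorem acceptProb_hybridB₁_ideal (χN : PMF (Fin n → ℤ)) (χh : PMF R) (m : ℕ) (ζ : PMF (Fin n → ℤ))
    (A : Distinguisher (Fin n) R m) :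
    acceptProb (hybridB₁ χh m A) (extLWEIdealZ k ζ χN m) = acceptProb A (hybridH₁ χN χh m ζ) := by
  unfold hybridB₁ extLWEIdealZ hybridH₁ acceptProb
  rw [PMF.bind_bind, PMF.bind_bind]
  refine congrArg (fun P : PMF Bool => P true) (congrArg _ (funext fun z => ?_))
  rw [PMF.bind_map, ← extLWEIdeal_bind_hybridT₁ χN χh m z, PMF.bind_bind]
  rfl

/-- `Pr[ℬ₁ | first case] = Pr[𝒜(H₂)]`. [cite: BrakerskiEtAl2013, Lemma 4.9 (proof)] -/
theorem acceptProb_hybridB₁_real (χN : PMF (Fin n → ℤ)) (χh : PMF R) (m : ℕ) (ζ : PMF (Fin n → ℤ))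
    (A : Distinguisher (Fin n) R m) :
    acceptProb (hybridB₁ χh m A) (extLWERealZ k ζ χN m) = acceptProb A (hybridH₂ (k := k) χN χh m ζ) := by
  unfold hybridB₁ extLWERealZ hybridH₂ lawCz acceptProb
  rw [PMF.bind_bind, PMF.bind_bind, PMF.bind_bind]
  refine congrArg (fun P : PMF Bool => P true) (congrArg _ (funext fun z => ?_))
  rw [PMF.bind_map, PMF.bind_map]
  show ((extLWEReal (n := k) χN m z).bind fun τ => (hybridT₁ χh m z τ).bind A) =
    (PMF.uniformOfFintype (Matrix (Fin k) (Fin n) R)).bind fun C => (hybridG χN χh m (C, C *ᵥ intCastVec z)).bind A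
  rw [← PMF.bind_bind, extLWEReal_bind_hybridT₁, PMF.bind_bind]

/-- `Pr[ℬ₂ | LWE] = Pr[𝒜(H₃)]`. [cite: BrakerskiEtAl2013, Lemma 4.9 (proof)] -/
theorem acceptProb_hybridB₂_lwe (χN : PMF (Fin n → ℤ)) (χh : PMF R) (m : ℕ) (A : Distinguisher (Fin n) R m) :
    acceptProb (hybridB₂ (k := k) χN m A) (lweSamplesUniformSecret χh m) = acceptProb A (hybridH₃ k χN χh m) := by
  unfold hybridB₂
  rw [acceptProb_comp_bind, lweSamplesUniformSecret_bind_hybridT₂]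

/-- `Pr[ℬ₂ | uniform] = Pr[𝒜(H₄)]`. [cite: BrakerskiEtAl2013, Lemma 4.9 (proof)] -/
theorem acceptProb_hybridB₂_uniform (χN : PMF (Fin n → ℤ)) (m : ℕ) (A : Distinguisher (Fin n) R m) :
    acceptProb (hybridB₂ (k := k) χN m A) (uniformSamples (Fin k) R m) = acceptProb A (hybridH₄ k χN m) := by
  unfold hybridB₂
  rw [acceptProb_comp_bind, uniformSamples_bind_hybridT₂]

/-- `Pr[ℬ₃ | first case] = Pr[𝒜(H₄)]`. [cite: BrakerskiEtAl2013, Lemma 4.9 (proof)] -/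
theorem acceptProb_hybridB₃_real (χN : PMF (Fin n → ℤ)) (m : ℕ) (A : Distinguisher (Fin n) R m) :
    acceptProb (hybridB₃ m A) (extLWEReal (n := k) χN m 0) = acceptProb A (hybridH₄ k χN m) := by
  unfold hybridB₃
  rw [acceptProb_comp_bind, extLWEReal_zero_bind_hybridT₃]

/-- `Pr[ℬ₃ | second case] = Pr[𝒜(H₅)] = Pr[𝒜(U)]`. [cite: BrakerskiEtAl2013, Lemma 4.9 (proof)] -/
theorem acceptProb_hybridB₃_ideal (χN : PMF (Fin n → ℤ)) (m : ℕ) (A : Distinguisher (Fin n) R m) :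
    acceptProb (hybridB₃ (k := k) m A) (extLWEIdeal k χN m 0) = acceptProb A (uniformSamples (Fin n) R m) := by
  unfold hybridB₃
  rw [acceptProb_comp_bind, extLWEIdeal_zero_bind_hybridT₃]

omit [CommRing R] [Fintype R] in
/-- **Tests see close inputs alike**: `|Pr[A(P)] - Pr[A(Q)]| ≤ Δ(P, Q)` (kernel contraction, event `{true}`).
[folklore] -/
theorem abs_toReal_acceptProb_sub_le_tvDist {β : Type} (A : β → PMF Bool) (P Q : PMF β) :
    |(acceptProb A P).toReal - (acceptProb A Q).toReal| ≤ P.tvDist Q := by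
  have h := PMF.abs_toReal_toOuterMeasure_bind_sub_le_tvDist P Q A {true}
  rwa [PMF.toOuterMeasure_apply_singleton, PMF.toOuterMeasure_apply_singleton] at h

/-- **`|Pr[𝒜(H₂)] - Pr[𝒜(H₃)]| ≤ Δ((C, Cz̄); U)`** — "by the leftover hash lemma, since `H₂, H₃` can be
derived from `(C, qCz)` and `(C, s)` respectively" (the same kernel `hybridG` applied to both).
[cite: BrakerskiEtAl2013, Lemma 4.9 (proof, H₂ vs H₃)] -/
theorem abs_acceptProb_hybridH₂_sub_hybridH₃_le (χN : PMF (Fin n → ℤ)) (χh : PMF R) (m : ℕ)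
    (ζ : PMF (Fin n → ℤ)) (A : Distinguisher (Fin n) R m) :
    |(acceptProb A (hybridH₂ (k := k) χN χh m ζ)).toReal - (acceptProb A (hybridH₃ k χN χh m)).toReal| ≤
      (lawCz k ζ).tvDist (PMF.uniformOfFintype (Matrix (Fin k) (Fin n) R × (Fin k → R))) := by
  unfold hybridH₂ hybridH₃
  rw [← acceptProb_comp_bind, ← acceptProb_comp_bind]
  exact abs_toReal_acceptProb_sub_le_tvDist _ _ _

/-! ### Lemma 4.9 from `H₁` on -/

/-- **BLPRS Lemma 4.9, the hybrid chain from `H₁`:** for every test `𝒜` on `m` samples of dimension `n`,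
every law `ζ` of the integer secret `z`, every integer noise-column law `χ_N` and ring noise `χ_h`,
`|Pr[𝒜(H₁)] - Pr[𝒜(U)]| ≤ Adv^{extLWE^m, z←ζ}[ℬ₁] + Δ((C, Cz̄); U) + Adv^{LWE_{k,m,χ_h}}[ℬ₂] + Adv^{extLWE^m, z=0}[ℬ₃]`
with the explicit adversaries `ℬ₁ = 𝒜 ∘ hybridT₁`, `ℬ₂ = 𝒜 ∘ hybridT₂`, `ℬ₃ = 𝒜 ∘ hybridT₃` (triangle
inequality through `H₂, H₃, H₄`; printed with `Δ ≤ δ` by Lemma 2.2 and the extra `4mε` of `H₀ ≈ H₁`).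
[cite: BrakerskiEtAl2013, Lemma 4.9] -/
theorem advantage_hybridH₁_le (χN : PMF (Fin n → ℤ)) (χh : PMF R) (m : ℕ) (ζ : PMF (Fin n → ℤ))
    (A : Distinguisher (Fin n) R m) :
    |(acceptProb A (hybridH₁ χN χh m ζ)).toReal - (acceptProb A (uniformSamples (Fin n) R m)).toReal| ≤
      extLWEAdvantageZ ζ χN m (hybridB₁ (k := k) χh m A) +
        (lawCz k ζ).tvDist (PMF.uniformOfFintype (Matrix (Fin k) (Fin n) R × (Fin k → R))) +
        distinguishingAdvantage χh m (hybridB₂ (k := k) χN m A) +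
        extLWEAdvantage χN m 0 (hybridB₃ (k := k) m A) := by
  have h12 : |(acceptProb A (hybridH₁ χN χh m ζ)).toReal -
      (acceptProb A (hybridH₂ (k := k) χN χh m ζ)).toReal| =
      extLWEAdvantageZ ζ χN m (hybridB₁ (k := k) χh m A) := by
    rw [extLWEAdvantageZ, acceptProb_hybridB₁_real, acceptProb_hybridB₁_ideal, abs_sub_comm]
  have h23 := abs_acceptProb_hybridH₂_sub_hybridH₃_le (k := k) χN χh m ζ A
  have h34 : |(acceptProb A (hybridH₃ k χN χh m)).toReal - (acceptProb A (hybridH₄ k χN m)).toReal| =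
      distinguishingAdvantage χh m (hybridB₂ (k := k) χN m A) := by
    rw [distinguishingAdvantage, acceptProb_hybridB₂_lwe, acceptProb_hybridB₂_uniform]
  have h45 : |(acceptProb A (hybridH₄ k χN m)).toReal -
      (acceptProb A (uniformSamples (Fin n) R m)).toReal| =
      extLWEAdvantage χN m 0 (hybridB₃ (k := k) m A) := by
    rw [extLWEAdvantage, acceptProb_hybridB₃_real, acceptProb_hybridB₃_ideal]
  have t1 := abs_sub_le (acceptProb A (hybridH₁ χN χh m ζ)).toReal
    (acceptProb A (hybridH₂ (k := k) χN χh m ζ)).toReal (acceptProb A (uniformSamples (Fin n) R m)).toReal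
  have t2 := abs_sub_le (acceptProb A (hybridH₂ (k := k) χN χh m ζ)).toReal
    (acceptProb A (hybridH₃ k χN χh m)).toReal (acceptProb A (uniformSamples (Fin n) R m)).toReal
  have t3 := abs_sub_le (acceptProb A (hybridH₃ k χN χh m)).toReal
    (acceptProb A (hybridH₄ k χN m)).toReal (acceptProb A (uniformSamples (Fin n) R m)).toReal
  linarith

end Model

end LWE

end Literature.Computability.Cryptography

end
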